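import Summits.CriticalPhenomena.CardyFormulaZ2.Theorems.CardySelfDualSegmentUniformMarginalityDefs
import Summits.CriticalPhenomena.CardyFormulaZ2.Theorems.CardyBoundaryCoulombGasRectilinearSufficesMixed

/-!
# Deterministic nesting of crude crossing events of conformal rectangles in mixed position

Support file of the line `Sketch` for the crux `UniformMarginality` (stmt-CriticalPhenomena-5472,
route `CardySelfDualSegment`), stub `crossEvent_subset_of_mixed` of the lead's skeleton: the
deterministic half of the transport of the crux from rectilinear to general conformal rectangles.

Two conformal rectangles `R'` (the *lower* one) and `R` (the *upper* one) are in **mixed position**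
when `closure R' ⊆ R ∪ F₀ ∪ F₂` for two compact pockets `F₀, F₂` off `R` and apart from each other,
`F₀` off a closed set `C₀ ⊇ ∂R ∖ arc₀(R)`, `F₂` off a closed set `C₂ ⊇ ∂R ∖ arc₂(R)` (so that `R'`
sticks out of `R` only across the arcs `0` and `2` of `R`), and the arcs `0`, `2` of `R'` lie
outside `closure R`, arc `0` off `F₂` and arc `2` off `F₀`. Then for all small meshes `δ` EVERY
lattice configuration `ω ⊆ E(ℤ²)` in the crude crossing event `crossEvent R' δ` (an open path with
all rescaled vertices `δ √2 y` in `R'` from within `2δ` of `R'.arc 0` to within `2δ` of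
`R'.arc 2`) lies in `crossEvent R δ` (`crossEvent_subset_of_mixed`).

Proof (same mathematics as `discreteCrossing_subset_of_mixed` of
`CardyBoundaryCoulombGasRectilinearSufficesSandwich.lean`, for the cruder discretisation
`embDomainCrossing` of `CardyFormula.lean`; no bulk hypothesis is needed since the crude event does
not ask for the largest mesh component): the start of the open `R'`-path is within `2δ` of
`R'.arc 0`, hence (small `δ`) in `F₀`, its end likewise in `F₂`; its vertices lie in
`R' ⊆ R ∪ F₀ ∪ F₂` and its steps are lattice edges of length `√2 δ ≤ 2δ < dist(F₀, F₂)`, so run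
extraction (`PathIn.exists_run`, `TriCrossingSandwich.lean`) yields a maximal run of steps between
vertices of `R` entered by a step from an `F₀`-vertex and left by a step into an `F₂`-vertex; the
entering step, from inside the open set `R` to outside, meets `∂R` at a point which is `2δ`-close to
`F₀`, hence not in `C₀`, hence on `R.arc 0`: the run starts within `2δ` of `R.arc 0`, and likewise
ends within `2δ` of `R.arc 2`. The purely combinatorial core is stated for an arbitrary vertex type
with a point map `P : V → ℂ` and a step bound `dist (P a) (P b) ≤ r` on open edges
(`openCrossing_near_subset_of_sep`).
-/

noncomputable section

namespace Summit.CriticalPhenomena.CardyFormulaZ2.Cruxes.UniformMarginality.HeatFlow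

open Set Metric
open Literature.Probability.Percolation Literature.Probability.LatticeModels
  Literature.Probability.RandomPlanarGeometry
open Summit.CriticalPhenomena.CardyFormulaZ2.Theorems

/-! ## §1 Paths: `openConnIn` versus the chain predicate `PathIn` -/

/-- A witness of `ω ∈ {x ⟷ y in S}` is an open path inside `S` (local copy of
`pathIn_of_mem_openConnIn` of `SharpnessDCTProofs.lean`, outside this import closure). -/
theorem pathIn_of_openConnIn {V : Type*} {S : Set V} {x y : V} {ω : BondConfig V}
    (h : ω ∈ openConnIn S x y) : PathIn (openGraph ω) S x y := by
  obtain ⟨hx, hy, hr⟩ := h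
  rw [SimpleGraph.reachable_iff_reflTransGen] at hr
  suffices key : ∀ b : S, Relation.ReflTransGen ((openGraph ω).induce S).Adj ⟨x, hx⟩ b →
      PathIn (openGraph ω) S x b.1 from key ⟨y, hy⟩ hr
  intro b hb
  induction hb with
  | refl => exact PathIn.refl hx
  | @tail c e _ hce ih =>
    simp only [SimpleGraph.comap_adj, Function.Embedding.coe_subtype] at hce
    exact ih.tail hce e.2

/-- An open path inside `S` witnesses `ω ∈ {x ⟷ y in S}` (local copy of
`mem_openConnIn_of_pathIn` of `SharpnessDCTProofs.lean`, outside this import closure). -/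
theorem openConnIn_of_pathIn {V : Type*} {S : Set V} {x y : V} {ω : BondConfig V}
    (h : PathIn (openGraph ω) S x y) : ω ∈ openConnIn S x y := by
  obtain ⟨hx, hr⟩ := h
  induction hr with
  | refl => exact ⟨hx, hx, SimpleGraph.Reachable.refl _⟩
  | @tail b c _ hbc ih =>
    obtain ⟨_, hb, hreach⟩ := ih
    refine ⟨hx, hbc.2, hreach.trans (SimpleGraph.Adj.reachable (?_ : ((openGraph ω).induce S).Adj
      ⟨b, hb⟩ ⟨c, hbc.2⟩))⟩
    simp only [SimpleGraph.comap_adj, Function.Embedding.coe_subtype]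
    exact hbc.1

/-- Transport of a path to a larger graph and another ambient set, step by step: if every
`H`-step is a `G`-step into `T` and the path starts in `T`, it is a `G`-path inside `T`. -/
theorem pathIn_of_forall_step {V : Type*} {H G : SimpleGraph V} {S T : Set V} {a b : V}
    (h : PathIn H S a b) (ha : a ∈ T) (hstep : ∀ p q, H.Adj p q → G.Adj p q ∧ q ∈ T) :
    PathIn G T a b := by
  obtain ⟨-, hr⟩ := h
  refine ⟨ha, ?_⟩
  induction hr with
  | refl => exact Relation.ReflTransGen.refl
  | tail _ hbc ih => exact ih.tail (hstep _ _ hbc.1)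

/-! ## §2 Two metric facts -/

/-- A point within `r` of a nonempty compact set `A` all of whose points are `> r` away from the
points of `T` is not in `T`. -/
theorem not_mem_of_infDist_le {A T : Set ℂ} (hA : IsCompact A) (hAne : A.Nonempty) {c : ℂ}
    {r : ℝ} (hc : infDist c A ≤ r) (hT : ∀ p ∈ A, ∀ q ∈ T, r < dist p q) : c ∉ T := by
  intro hcT
  obtain ⟨p, hp, hpd⟩ := hA.exists_infDist_eq_dist hAne c
  have h1 : dist c p ≤ r := hpd ▸ hc
  have h2 := hT p hp c hcT
  rw [dist_comm] at h2
  exact absurd h1 (not_le.2 h2)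

/-- **The arc condition at an end of the extracted run.** If `c` lies in the open set `Ω`, within
`r` of a point `p ∉ Ω` which is `> r` away from a set `C ⊇ ∂Ω ∖ A`, then `c` is within `r` of `A`:
the segment `[c, p]` leaves `Ω` through a frontier point within `r` of both ends, and that point is
not in `C`. -/
theorem infDist_le_of_exit {Ω A C : Set ℂ} (hΩ : IsOpen Ω) {c p : ℂ} {r : ℝ} (hc : c ∈ Ω)
    (hp : p ∉ Ω) (hd : dist c p ≤ r) (hfr : frontier Ω \ A ⊆ C) (hC : ∀ q ∈ C, r < dist p q) :
    infDist c A ≤ r := by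
  have hns : ¬ segment ℝ c p ⊆ Ω := fun hs => hp (hs (right_mem_segment _ _ _))
  obtain ⟨w, hw, hwf⟩ := exists_mem_segment_frontier hΩ hc hns
  have hcw : dist c w ≤ r := (Theorems.dist_le_of_mem_segment_left hw).trans hd
  have hpw : dist p w ≤ r := by
    have := Theorems.dist_le_of_mem_segment_right hw
    rw [dist_comm] at this
    exact this.trans hd
  have hwA : w ∈ A := by
    by_contra hwA
    have := hC w (hfr ⟨hwf, hwA⟩)
    linarith
  exact (infDist_le_dist_of_mem hwA).trans hcw

/-! ## §3 The combinatorial core -/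

/-- **Nesting of crude crossing events, combinatorial core.** Vertices `V` are drawn in the plane
by `P`, open edges have drawn length `≤ r`, and the crude crossing event of `(Ω; A₀, A₂)` is
`openCrossing {P ∈ Ω} {infDist P A₀ ≤ r} {infDist P A₂ ≤ r}`. If `Ω' ⊆ Ω ∪ F₀ ∪ F₂` with `Ω` open,
`F₀, F₂` off `Ω`, `∂Ω ∖ A₀ ⊆ C₀`, `∂Ω ∖ A₂ ⊆ C₂`, the compact nonempty sets `A₀', A₂'` being `> r`
away from `Ω` and from `F₂`, `F₀` respectively, and `F₀` being `> r` away from `F₂` and `C₀`, `F₂`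
from `C₂`, then the crude crossing event of `(Ω'; A₀', A₂')` is contained in that of
`(Ω; A₀, A₂)`. -/
theorem openCrossing_near_subset_of_sep {V : Type*} (P : V → ℂ) {r : ℝ}
    {Ω' Ω A0' A2' A0 A2 F0 F2 C0 C2 : Set ℂ} (hΩ : IsOpen Ω)
    (hcl : Ω' ⊆ Ω ∪ F0 ∪ F2) (hF0 : Disjoint F0 Ω) (hF2 : Disjoint F2 Ω)
    (hfr0 : frontier Ω \ A0 ⊆ C0) (hfr2 : frontier Ω \ A2 ⊆ C2)
    (hA0' : IsCompact A0') (hA0'ne : A0'.Nonempty) (hA2' : IsCompact A2') (hA2'ne : A2'.Nonempty)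
    (h1 : ∀ p ∈ F0, ∀ q ∈ F2, r < dist p q)
    (h2 : ∀ p ∈ F0, ∀ q ∈ C0, r < dist p q)
    (h3 : ∀ p ∈ F2, ∀ q ∈ C2, r < dist p q)
    (h4 : ∀ p ∈ A0', ∀ q ∈ Ω, r < dist p q)
    (h5 : ∀ p ∈ A2', ∀ q ∈ Ω, r < dist p q)
    (h6 : ∀ p ∈ A0', ∀ q ∈ F2, r < dist p q)
    (h7 : ∀ p ∈ A2', ∀ q ∈ F0, r < dist p q)
    {ω : BondConfig V} (hω : ∀ a b, (openGraph ω).Adj a b → dist (P a) (P b) ≤ r)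
    (hmem : ω ∈ openCrossing {y | P y ∈ Ω'} {u | infDist (P u) A0' ≤ r}
      {v | infDist (P v) A2' ≤ r}) :
    ω ∈ openCrossing {y | P y ∈ Ω} {u | infDist (P u) A0 ≤ r} {v | infDist (P v) A2 ≤ r} := by
  obtain ⟨x, hx, y, hy, hxy⟩ := hmem
  have hP : PathIn (openGraph ω) {y | P y ∈ Ω'} x y := pathIn_of_openConnIn hxy
  -- vertices of `Ω'` outside `Ω` are drawn in `F₀` or in `F₂`
  have hout : ∀ {a : V}, a ∈ {y | P y ∈ Ω'} → P a ∉ Ω → P a ∈ F0 ∨ P a ∈ F2 := by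
    intro a ha haΩ
    rcases hcl ha with (h | h) | h
    · exact absurd h haΩ
    · exact Or.inl h
    · exact Or.inr h
  have hF0Ω : ∀ {c : ℂ}, c ∈ F0 → c ∉ Ω := fun hc hcΩ => Set.disjoint_left.1 hF0 hc hcΩ
  have hF2Ω : ∀ {c : ℂ}, c ∈ F2 → c ∉ Ω := fun hc hcΩ => Set.disjoint_left.1 hF2 hc hcΩ
  have hF02 : ∀ {c : ℂ}, c ∈ F0 → c ∉ F2 := by
    intro c hc hc'
    have := h1 c hc c hc'
    rw [dist_self] at this
    exact absurd (infDist_nonneg.trans hx) (not_le.2 this)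
  -- the ends of the path are drawn in `F₀` and `F₂`
  have hxF : P x ∈ F0 := by
    have hxΩ : P x ∉ Ω := not_mem_of_infDist_le hA0' hA0'ne hx h4
    exact (hout hP.left_mem hxΩ).resolve_right (not_mem_of_infDist_le hA0' hA0'ne hx h6)
  have hyF : P y ∈ F2 := by
    have hyΩ : P y ∉ Ω := not_mem_of_infDist_le hA2' hA2'ne hy h5
    exact (hout hP.right_mem hyΩ).resolve_left (not_mem_of_infDist_le hA2' hA2'ne hy h7)
  -- the three kinds of steps
  let H : SimpleGraph V :=
    { Adj := fun a b => (openGraph ω).Adj a b ∧ P a ∈ Ω ∧ P b ∈ Ω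
      symm := ⟨fun a b h => ⟨h.1.symm, h.2.2, h.2.1⟩⟩
      loopless := ⟨fun a h => h.1.ne rfl⟩ }
  set L₀ : V → V → Prop := fun a b => P a ∈ F0 ∨ P b ∈ F0 with hL₀
  set L₂ : V → V → Prop := fun a b => P a ∈ F2 ∨ P b ∈ F2 with hL₂
  have hHG : H ≤ openGraph ω := fun a b h => h.1
  have hclass : ∀ a ∈ {y | P y ∈ Ω'}, ∀ b ∈ {y | P y ∈ Ω'}, (openGraph ω).Adj a b →
      H.Adj a b ∨ L₀ a b ∨ L₂ a b := by
    intro a ha b hb hab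
    by_cases haΩ : P a ∈ Ω
    · by_cases hbΩ : P b ∈ Ω
      · exact Or.inl ⟨hab, haΩ, hbΩ⟩
      · rcases hout hb hbΩ with h | h
        · exact Or.inr (Or.inl (Or.inr h))
        · exact Or.inr (Or.inr (Or.inr h))
    · rcases hout ha haΩ with h | h
      · exact Or.inr (Or.inl (Or.inl h))
      · exact Or.inr (Or.inr (Or.inl h))
  have hu : ∀ b ∈ {y | P y ∈ Ω'}, (openGraph ω).Adj x b → ¬ H.Adj x b ∧ L₀ x b :=
    fun b _ _ => ⟨fun h => hF0Ω hxF h.2.1, Or.inl hxF⟩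
  have hv : ∀ a ∈ {y | P y ∈ Ω'}, (openGraph ω).Adj a y → ¬ H.Adj a y ∧ ¬ L₀ a y := by
    intro a _ hay
    refine ⟨fun h => hF2Ω hyF h.2.2, ?_⟩
    rintro (haF | hyF')
    · have := h1 _ haF _ hyF
      have := hω a y hay
      linarith
    · exact hF02 hyF' hyF
  have huv : x ≠ y := by
    rintro rfl
    exact hF02 hxF hyF
  -- run extraction
  obtain ⟨a', a, b, b', -, ha'a, -, hL0, hrun, -, hbb', -, hnL0, hL2⟩ :=
    PathIn.exists_run (H := H) (L₀ := L₀) (L₂ := L₂) hHG hclass hu hv huv hP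
  have hbF0 : P b ∉ F0 := fun h => hnL0 (Or.inl h)
  -- the ends of the run are drawn in `Ω`
  have haΩ : P a ∈ Ω := by
    by_cases hab : a = b
    · subst hab
      have ha'F : P a' ∈ F0 := hL0.resolve_right hbF0
      have haF2 : P a ∉ F2 := by
        intro haF2
        have := h1 _ ha'F _ haF2
        have := hω a' a ha'a
        linarith
      by_contra haΩ
      rcases hout hrun.left_mem haΩ with h | h
      · exact hbF0 h
      · exact haF2 h
    · obtain ⟨c, -, hac⟩ := PathIn.exists_adj_head hrun hab
      exact hac.2.1
  have hbΩ : P b ∈ Ω := by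
    by_cases hab : a = b
    · exact hab ▸ haΩ
    · obtain ⟨c, -, hcb⟩ := PathIn.exists_adj_last hrun hab
      exact hcb.2.2
  have ha'F : P a' ∈ F0 := hL0.resolve_right (fun h => hF0Ω h haΩ)
  have hb'F : P b' ∈ F2 := hL2.resolve_left (fun h => hF2Ω h hbΩ)
  -- the arc conditions at the two ends
  have harc_a : infDist (P a) A0 ≤ r := by
    refine infDist_le_of_exit hΩ haΩ (hF0Ω ha'F) ?_ hfr0 (fun q hq => h2 _ ha'F q hq)
    rw [dist_comm]
    exact hω a' a ha'a
  have harc_b : infDist (P b) A2 ≤ r :=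
    infDist_le_of_exit hΩ hbΩ (hF2Ω hb'F) (hω b b' hbb') hfr2 (fun q hq => h3 _ hb'F q hq)
  -- the run is an open path inside `{P ∈ Ω}`
  have hpath : PathIn (openGraph ω) {y | P y ∈ Ω} a b :=
    pathIn_of_forall_step hrun haΩ (fun p q hpq => ⟨hpq.1, hpq.2.2⟩)
  exact ⟨a, harc_a, b, harc_b, openConnIn_of_pathIn hpath⟩

/-! ## §4 The square lattice `√2 ℤ²` at mesh `δ` -/

/-- The rescaled embedded vertex `δ · √2 (y₀ + i y₁)` is the mesh point of `y` at mesh `δ √2`. -/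
theorem delta_mul_z_eq_meshPoint (δ : ℝ) (y : Site 2) :
    (δ : ℂ) * squareLatticeEmbedding.z y = meshPoint (δ * Real.sqrt 2) y := by
  simp only [meshPoint, Complex.ofReal_mul, mul_assoc]
  rfl

/-- Open edges of a lattice configuration `ω ⊆ E(ℤ²)` have rescaled length `√2 δ ≤ 2δ`
(`δ ≥ 0`). -/
theorem dist_le_of_openGraph_adj {δ : ℝ} (hδ : 0 ≤ δ) {ω : BondConfig (Site 2)}
    (hω : ω ⊆ (zdGraph 2).edgeSet) {a b : Site 2} (hab : (openGraph ω).Adj a b) :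
    dist ((δ : ℂ) * squareLatticeEmbedding.z a) ((δ : ℂ) * squareLatticeEmbedding.z b) ≤
      2 * δ := by
  have hzd : (zdGraph 2).Adj a b := hω ((openGraph_adj ω a b).1 hab).1
  rw [delta_mul_z_eq_meshPoint, delta_mul_z_eq_meshPoint, dist_meshPoint_of_adj hzd,
    abs_of_nonneg (mul_nonneg hδ (Real.sqrt_nonneg 2))]
  nlinarith [Real.sq_sqrt (show (0 : ℝ) ≤ 2 by norm_num), Real.sqrt_nonneg 2]

/-! ## §5 The stub: crude crossing events of conformal rectangles in mixed position are nested -/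

/-- **Crude crossing events in mixed position are nested at a fixed mesh**, given the metric
separations at scale `2δ`: `F₀` is `> 2δ` away from `F₂` and `C₀`, `F₂` from `C₂`, `R'.arc 0` from
`closure R` and `F₂`, `R'.arc 2` from `closure R` and `F₀`. -/
theorem crossEvent_subset_of_sep {R' R : ConformalRectangle} {F0 F2 C0 C2 : Set ℂ} {δ : ℝ}
    (hδ : 0 < δ) (hcl : closure R'.carrier ⊆ R.carrier ∪ F0 ∪ F2)
    (hF0R : Disjoint F0 R.carrier) (hF2R : Disjoint F2 R.carrier)
    (hfr0 : frontier R.carrier \ R.arc 0 ⊆ C0) (hfr2 : frontier R.carrier \ R.arc 2 ⊆ C2)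
    (h1 : ∀ p ∈ F0, ∀ q ∈ F2, 2 * δ < dist p q)
    (h2 : ∀ p ∈ F0, ∀ q ∈ C0, 2 * δ < dist p q)
    (h3 : ∀ p ∈ F2, ∀ q ∈ C2, 2 * δ < dist p q)
    (h4 : ∀ p ∈ R'.arc 0, ∀ q ∈ closure R.carrier, 2 * δ < dist p q)
    (h5 : ∀ p ∈ R'.arc 2, ∀ q ∈ closure R.carrier, 2 * δ < dist p q)
    (h6 : ∀ p ∈ R'.arc 0, ∀ q ∈ F2, 2 * δ < dist p q)
    (h7 : ∀ p ∈ R'.arc 2, ∀ q ∈ F0, 2 * δ < dist p q)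
    {ω : BondConfig (Site 2)} (hω : ω ⊆ (zdGraph 2).edgeSet) (hmem : ω ∈ crossEvent R' δ) :
    ω ∈ crossEvent R δ :=
  openCrossing_near_subset_of_sep (fun y => (δ : ℂ) * squareLatticeEmbedding.z y) R.isOpen
    (subset_closure.trans hcl) hF0R hF2R hfr0 hfr2 (R'.isCompact_arc 0) ⟨_, R'.pt_mem_arc_self 0⟩
    (R'.isCompact_arc 2) ⟨_, R'.pt_mem_arc_self 2⟩ h1 h2 h3
    (fun p hp q hq => h4 p hp q (subset_closure hq))
    (fun p hp q hq => h5 p hp q (subset_closure hq)) h6 h7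
    (fun _ _ hab => dist_le_of_openGraph_adj hδ.le hω hab) hmem

/-- **Stub `crossEvent_subset_of_mixed` of the line `Sketch`: crude crossing events of conformal
rectangles in mixed position are nested for all small meshes.** If `R'` (lower) sticks out of `R`
(upper) only through two compact pockets `F₀, F₂` hanging off the arcs `0` and `2` of `R`
(`closure R' ⊆ R ∪ F₀ ∪ F₂`; `F₀, F₂` off `R` and apart; `F₀` off the closed `C₀ ⊇ ∂R ∖ arc₀`,
`F₂` off the closed `C₂ ⊇ ∂R ∖ arc₂`; the arcs `0`, `2` of `R'` off `closure R`, arc `0` off `F₂`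
and arc `2` off `F₀`), then there is `δ₀ > 0` such that for every mesh `0 < δ < δ₀` every lattice
configuration `ω ⊆ E(ℤ²)` with a crude crossing of `R'` has a crude crossing of `R`. The threshold
is half the least of the seven distances between the disjoint compact/closed pairs
(`exists_pos_forall_lt_dist`). -/
theorem crossEvent_subset_of_mixed :
    ∀ (R' R : ConformalRectangle) (F0 F2 C0 C2 : Set ℂ), IsCompact F0 → IsCompact F2 →
      IsClosed C0 → IsClosed C2 →
      closure R'.carrier ⊆ R.carrier ∪ F0 ∪ F2 → Disjoint F0 R.carrier → Disjoint F2 R.carrier →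
      Disjoint F0 F2 →
      frontier R.carrier \ R.arc 0 ⊆ C0 → frontier R.carrier \ R.arc 2 ⊆ C2 → Disjoint F0 C0 →
      Disjoint F2 C2 →
      Disjoint (R'.arc 0) (closure R.carrier) → Disjoint (R'.arc 2) (closure R.carrier) →
      Disjoint (R'.arc 0) F2 → Disjoint (R'.arc 2) F0 →
      ∃ δ₀ > 0, ∀ δ, 0 < δ → δ < δ₀ → ∀ ω : BondConfig (Site 2), ω ⊆ (zdGraph 2).edgeSet →
        ω ∈ crossEvent R' δ → ω ∈ crossEvent R δ := by
  intro R' R F0 F2 C0 C2 hF0 hF2 hC0 hC2 hcl hF0R hF2R hF02 hfr0 hfr2 hF0C hF2C hA0 hA2 hA0F hA2F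
  -- the seven positive separations
  obtain ⟨d1, hd1, h1⟩ := exists_pos_forall_lt_dist hF0 hF2.isClosed hF02
  obtain ⟨d2, hd2, h2⟩ := exists_pos_forall_lt_dist hF0 hC0 hF0C
  obtain ⟨d3, hd3, h3⟩ := exists_pos_forall_lt_dist hF2 hC2 hF2C
  obtain ⟨d4, hd4, h4⟩ := exists_pos_forall_lt_dist (R'.isCompact_arc 0) isClosed_closure hA0
  obtain ⟨d5, hd5, h5⟩ := exists_pos_forall_lt_dist (R'.isCompact_arc 2) isClosed_closure hA2
  obtain ⟨d6, hd6, h6⟩ := exists_pos_forall_lt_dist (R'.isCompact_arc 0) hF2.isClosed hA0F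
  obtain ⟨d7, hd7, h7⟩ := exists_pos_forall_lt_dist (R'.isCompact_arc 2) hF0.isClosed hA2F
  -- the threshold
  obtain ⟨δ₀, hδ₀, hε1, hε2, hε3, hε4, hε5, hε6, hε7⟩ : ∃ δ₀ > 0, 2 * δ₀ ≤ d1 ∧ 2 * δ₀ ≤ d2 ∧
      2 * δ₀ ≤ d3 ∧ 2 * δ₀ ≤ d4 ∧ 2 * δ₀ ≤ d5 ∧ 2 * δ₀ ≤ d6 ∧ 2 * δ₀ ≤ d7 := by
    refine ⟨min (min (min d1 d2) (min d3 d4)) (min (min d5 d6) d7) / 2, by positivity,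
      ?_, ?_, ?_, ?_, ?_, ?_, ?_⟩ <;>
    · simp only [min_le_iff, le_refl, true_or, or_true,
        mul_div_cancel₀ _ (by norm_num : (2 : ℝ) ≠ 0)]
  refine ⟨δ₀, hδ₀, fun δ hδ hδlt ω hω hmem => ?_⟩
  have hδ2 : 2 * δ < 2 * δ₀ := by linarith
  exact crossEvent_subset_of_sep hδ hcl hF0R hF2R hfr0 hfr2
    (fun p hp q hq => by linarith [h1 p hp q hq])
    (fun p hp q hq => by linarith [h2 p hp q hq])
    (fun p hp q hq => by linarith [h3 p hp q hq])
    (fun p hp q hq => by linarith [h4 p hp q hq])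
    (fun p hp q hq => by linarith [h5 p hp q hq])
    (fun p hp q hq => by linarith [h6 p hp q hq])
    (fun p hp q hq => by linarith [h7 p hp q hq]) hω hmem

end Summit.CriticalPhenomena.CardyFormulaZ2.Cruxes.UniformMarginality.HeatFlow

end
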